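import Summits.BirchSwinnertonDyer.BirchSwinnertonDyer.Theses.PrintX11a
import Literature.NumberTheory.EllipticCurves.QuadraticTwist
import Literature.NumberTheory.EllipticCurves.DivisionField
import HarnessLib

/-!
# Line «twinflip5» for crux `PrintX11a.UpperNonSurjFive` (item stmt-BirchSwinnertonDyer-20614)

bsd-idea-6 g4, lens «decomp» (technique: compute one thing two ways — `Ш(E/K)[p^∞] = Ш(E)[p^∞] ⊕ Ш(E^d)[p^∞]`
for an imaginary quadratic `K = ℚ(√d)`, `p` odd). Publish-only (W-79): the line of record for this item is
`Lines/finemu5.lean`; this file registers nothing.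

THE CUT. For a Class-X11a pair `(E, p)` with `E[p]` irreducible non-surjective and `p ≥ 5` choose an
ADMISSIBLE TWIN: a fundamental discriminant `d < 0`, `d ≡ 1 (mod 8)`, with `p` INERT in `K = ℚ(√d)` and every
other bad prime of `E` SPLIT in `K`, such that the twist `E^d` has `L(E^d, 1) ≠ 0` (Friedberg–Hoffstein /
Bump–Friedberg–Hoffstein: infinitely many). Then `(E^d, p)` is again a Class-X11a pair (same `E[p] ⊗ χ_d`, still
multiplicative at `p`, no (ram) witness), `L(E/K, 1) = L(E,1) L(E^d,1) ≠ 0`, and the sign of `E/K` is `+1` with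
the DEFINITE quaternion algebra ramified exactly at `{p, ∞}`: its Gross points of level `M = N/p` are the
supersingular points of `X₀(M)` in characteristic `p`.

  UpperNonSurjFive  ⟸  TwinPairUpper  +  TwinExists  +  X11aLowerHalf (item 19064, BY NAME):
  `ord_p #Ш(E) ≤ [ord_p #Ш(E) + ord_p #Ш(E^d)] − ord_p #Ш(E^d) ≤ [ord_p Ш_an(E) + ord_p Ш_an(E^d)] − ord_p Ш_an(E^d)`.

`TwinPairUpper` (the joint Euler-system half for the pair) is STRICTLY WEAKER than `UpperNonSurjFive` (it is the
sum of the upper halves of two U5 pairs) and its natural proof is NOT Kato's: it is the level-0 bipartite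
(Bertolini–Darmon 2005) Euler system of Gross points over `K`, whose Chebotarev input is an ADMISSIBLE prime
(Frobenius semisimple with eigenvalue ratio `≠ ±1`), which EXISTS at the tame images 5Ns = N(C_s(5)) ⊇ diag(1,2),
5S4 and 7Ns ⊇ diag(1,3) — whereas Kato/Rubin need a transvection, impossible when `p ∤ #G`
(`Literature.Barriers.BirchSwinnertonDyer.EulerSystemBigImageAtSmallImage`). No cyclotomic or anticyclotomic
`μ`-invariant enters at level 0 (Kim 2024, Rem. 2.1: "we do not use anticyclotomic Iwasawa theory at all").
PRINT ANCHORS (tree-typed for the X7 cell): `Kim2024.thm523_natCard_selmerGroupPInfty_eq_pow_of_unitToricPeriod`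
(TAMS 2024 Thm 5.23, rank-0 length form: `#Sel_{p^∞}(E/K) = p^{2 ord_p λ₁}`), `CaiShuTian2014.thm12_trivialChar`
(explicit Waldspurger/Gross formula), `WZhang2014.thm64_padicValNat_congruenceNumber_eq` + `RibetTakahashiDefinite`
(Gross period vs Néron periods: the congruence-number ratio at the discriminant is the geometric component group,
which over `K_p = ℚ_{p²}` is exactly the Tamagawa factor `c_p(E/K) = v_p(Δ)`). What is BEYOND PRINT: Kim 2024 §2.1
needs (a) `ρ̄` SURJECTIVE and (d) GOOD reduction at `p` when `ν(N⁻)` is odd; Bertolini–Longo–Venerucci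
(arXiv:2306.17784) v1 (2023) stated Hyp. 1.1 with IRREDUCIBLE, but v2 = Math. Ann. 2026 RE-IMPOSED "surjective"
("used for the level raising results of Section 3"; tree `BertoliniLongoVenerucci2026.RevisedHypothesis` — the X9
cell's per-pair `DefiniteGrossPeriodRoute` at image 5S4 was withdrawn on exactly this), and keeps `p ∤ N`;
BD05/PW11/CH15/Sweeting 2020 keep `SL₂ ⊆ im ρ̄`. So the small-image level-raising/freeness step is an OPEN problem
acknowledged in print, not a clerical audit; this line's bet is that it is a finite Hecke-algebra problem (freeness
of the character group of the `{p,∞}`/`{p,ℓ}` Brandt modules at a non-Eisenstein, `p`-distinguished `𝔪_E`), far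
more tractable than Greenberg's `μ = 0`, and that the g3 note "Candidate B, do not open" is superseded by the typed
class-wide redirect through the route's own crux 19064 below (g3 had only a sub-locus joint bound). Here `p ∥ N` sits
IN the discriminant of the definite algebra (`E/K_p` split multiplicative: the setting of Bertolini–Darmon 1998/99,
where the `p`-adic family has a local zero at `𝟙` — irrelevant at level 0, where `θ₀` is Gross's special value) and
the image is tame. Second price: the level-0 bound sees no Tamagawa exponents at split `q ≠ p`, so it is sharp
exactly on the locus "no split-multiplicative `q ≠ p`" (`¬Ram` forces `p ∣ c_q` at a split-multiplicative `q`);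
off it a Jetchev-type divisibility of the bipartite classes is needed. See `Lines/twinflip5.md`.

BSD is not proved by any of this.
-/

namespace Summit.BirchSwinnertonDyer.BirchSwinnertonDyer.Cruxes.UpperNonSurjFive.TwinFlip

open WeierstrassCurve
open Literature.NumberTheory.EllipticCurves
open Literature.NumberTheory.EllipticCurves.Rank1Residual
open Literature.NumberTheory.EllipticCurves.Rank1Residual.Typed
open Summit.BirchSwinnertonDyer.Rank1Residual
open Summit.BirchSwinnertonDyer.BirchSwinnertonDyer.Theses

/-- `W'` is a (globally minimal) model of the quadratic twist of `W` by `d`: `W' ≅_ℚ W^d`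
(phrasing of `WeierstrassCurve.frobeniusTrace_quadraticTwist`). [folklore] -/
def IsTwistModel (W W' : WeierstrassCurve ℚ) (d : ℤ) : Prop :=
  ∃ C : VariableChange ℚ, C • W' = W.quadraticTwist (d : ℚ)

/-- ADMISSIBLE TWIN DISCRIMINANT for `(W, p)`: `d < 0` squarefree with `d ≡ 1 (mod 8)` (so `D_K = d` is odd and
`2` splits in `K = ℚ(√d)`), `p` inert in `K` (`(d/p) = −1`, in particular `p ∤ d`), and every odd bad prime
`q ≠ p` of `W` split in `K` (`(d/q) = +1`, in particular `q ∤ d`). Then `(d, 2pN) = 1`, the sign of `E/K` is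
`+1` (exactly one inert prime, `p`, divides `N` to odd order) and the relevant quaternion algebra is the definite
one ramified at `{p, ∞}`; finally `√d ∉ ℚ(E[p])` (`K` linearly disjoint from the `p`-division field, so that
Chebotarev conditions in `Gal(K(E[p^n])/ℚ) = Gal(K/ℚ) × Gal(ℚ(E[p^n])/ℚ)` decouple: admissible primes inert in
`K` exist, and `H¹(K(E[p^n])/K, E[p^n]) = H¹(ℚ(E[p^n])/ℚ, E[p^n])`). [cite: BertoliniDarmon2005, §1 p. 2] -/
def AdmissibleDisc (W : WeierstrassCurve ℚ) (p : ℕ) [Fact p.Prime] (d : ℤ) : Prop :=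
  d < 0 ∧ Squarefree d ∧ d % 8 = 1 ∧ legendreSym p d = -1 ∧
    (∀ (q : ℕ) [Fact q.Prime], q ≠ p → q ≠ 2 → ¬ W.HasGoodReductionAtPrime q → legendreSym q d = 1) ∧
    ∀ x : AlgebraicClosure ℚ, x ∈ W.divisionField p → x ^ 2 ≠ algebraMap ℚ (AlgebraicClosure ℚ) (d : ℚ)

/-- JOINT upper bound for the pair `(W, W')` at `p`, in Miller's currency (`Typed.MissingUpperBoundAt` summed):
`ord_p #Ш(W) + ord_p #Ш(W') ≤ ord_p Ш_an(W) + ord_p Ш_an(W')` with both analytic orders rational.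
For `W'` a model of `W^d`, `K = ℚ(√d)`, `p` odd, the left side is `ord_p #Ш(E/K)` and the right side is
`ord_p Ш_an(E/K)` (BSD invariants of `E/K` factor over the pair `E, E^d` up to `p`-units for `p` odd,
`(d, N) = 1`). [cite: Miller2011LMS, Def. 1.1] -/
def PairUpperAt (W W' : WeierstrassCurve ℚ) (p : ℕ) : Prop :=
  ∃ q q' : ℚ, shaAn W = (q : ℂ) ∧ shaAn W' = (q' : ℂ) ∧
    (padicValNat p W.shaOrder : ℤ) + (padicValNat p W'.shaOrder : ℤ) ≤ padicValRat p q + padicValRat p q'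

/-- STUB STATEMENT TF1 (the research stub — level-0 bipartite Euler system over `K` at tame image, `p ∥ N`
in the discriminant of the definite algebra): for every U5 pair and every admissible rank-0 twin, the JOINT
upper bound holds. WEAKER than `UpperNonSurjFive` — literally the sum of two of its instances
(`twinPairUpper_of_upperNonSurjFive` below, proved); the converse needs the twin's LOWER half. -/
def TwinPairUpper : Prop :=
  ∀ (W : WeierstrassCurve ℚ) [W.IsElliptic] [W.IsGloballyMinimal] (p : ℕ) [Fact p.Prime],
    ClassX11a W p → ¬ Surj W p → 5 ≤ p →
    ∀ (W' : WeierstrassCurve ℚ) [W'.IsElliptic] [W'.IsGloballyMinimal] (d : ℤ),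
      AdmissibleDisc W p d → IsTwistModel W W' d → ClassX11a W' p → ¬ Surj W' p → PairUpperAt W W' p

/-- STUB STATEMENT TF2 (print: Friedberg–Hoffstein 1995 Thm B with prescribed local behaviour + twist
bookkeeping at `p` and at the bad primes): every U5 pair has an admissible twin which is again a Class-X11a
pair (rank 0, multiplicative at `p`, irreducible, no (ram) witness) with the same non-surjective image
(`im(ρ̄ ⊗ χ_d) ⊇ SL₂ ⟺ im ρ̄ ⊇ SL₂` for `p ≥ 5`, `SL₂(𝔽_p)` perfect). -/
def TwinExists : Prop :=
  ∀ (W : WeierstrassCurve ℚ) [W.IsElliptic] [W.IsGloballyMinimal] (p : ℕ) [Fact p.Prime],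
    ClassX11a W p → ¬ Surj W p → 5 ≤ p →
    ∃ (d : ℤ) (W' : WeierstrassCurve ℚ) (_ : W'.IsElliptic) (_ : W'.IsGloballyMinimal),
      AdmissibleDisc W p d ∧ IsTwistModel W W' d ∧ ClassX11a W' p ∧ ¬ Surj W' p

/-! ## Stubs (sorried; publish-only, not registered) -/

/-- stub TF1 — joint upper bound for admissible twins (beyond print: Kim 2024 Thm 5.23 / BLV 2023 Thm B at
`χ = 𝟙` with (sur) ↦ tame irreducible image [BLV v1 claimed irreducible, v2 withdrew it] AND `p ∥ N` in the
definite discriminant [all print: `p ∤ N`]; Tamagawa sharpness off the no-split-multiplicative locus). The uses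
of a big image in the printed proofs are enumerable — (1) supply of admissible primes: needs `g ∈ im ρ̄` with
eigenvalues `{δ, δλ}`, `δ = ±1`, `λ ≠ ±1` — SETTLED class-wide: `ρ̄|I_p ≅ ω ⊕ 1` (finite flat at the
multiplicative `p`) contains `diag(u,1)`, `u` of order `p − 1 ≥ 4`; (2) `H¹(K(E[pⁿ])/K, E[pⁿ]) = 0`:
Lawson–Wuthrich 2016 / Cha 2005 at tame image; (3) weak level raising at admissible `ℓ` AND freeness /
multiplicity one of the character groups of the `{p,∞}`- and `{p,ℓ,…}`-Brandt modules at `𝔪_E` — THE open step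
(BLV v2 Remark after Hyp. 1.1; PW11 Thm 6.2 via Helm 2007 needs CR ∋ surjective and `p ∤ N`; with `p` in the level
only Ribet 1990's `p`-distinguished multiplicity one for `X_p(J₀(pM))` is available). -/
theorem stub_twinPairUpper : TwinPairUpper := by
  sorry

/-- stub TF2 — existence of an admissible Class-X11a twin (Friedberg–Hoffstein 1995 Thm B; BFH 1990). -/
theorem stub_twinExists : TwinExists := by
  sorry

/-- stub TF3 — the route's lower-half crux, BY NAME (item stmt-BirchSwinnertonDyer-19064; consumed by `closes`
anyway). Only its instances at admissible twins of U5 pairs are used. -/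
theorem stub_lowerHalf : PrintX11a.X11aLowerHalf := by
  sorry

/-! ## Glue (real proofs) -/

/-- THE FLIP: a joint upper bound for `(W, W')` and the lower bound for `W'` give the upper bound for `W`
(the rational value of `Ш_an(W')` is unique). [cite: Miller2011LMS, Def. 1.1] -/
theorem missingUpperBoundAt_of_pairUpperAt_of_lower {W W' : WeierstrassCurve ℚ} {p : ℕ}
    (h : PairUpperAt W W' p) (hl : MissingLowerBoundAt W' p) : MissingUpperBoundAt W p := by
  obtain ⟨q, q', hq, hq', hle⟩ := h
  obtain ⟨q'', hq'', hl'⟩ := hl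
  have hqq : q'' = q' := by exact_mod_cast hq''.symm.trans hq'
  subst hqq
  refine ⟨q, hq, ?_⟩
  linarith

/-- Two upper halves give the joint upper bound. [cite: Miller2011LMS, Def. 1.1] -/
theorem pairUpperAt_of_upper_of_upper {W W' : WeierstrassCurve ℚ} {p : ℕ}
    (h : MissingUpperBoundAt W p) (h' : MissingUpperBoundAt W' p) : PairUpperAt W W' p := by
  obtain ⟨q, hq, hle⟩ := h
  obtain ⟨q', hq', hle'⟩ := h'
  exact ⟨q, q', hq, hq', by linarith⟩

/-- REDUCTION AXIS, formal: the crux implies TF1 (TF1 is the sum of the crux at `W` and at the twin `W'`,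
itself a U5 pair). So TF1 is a CONSEQUENCE of `UpperNonSurjFive`, used toward it via the twin's lower half;
it is not the crux reworded (the converse needs `X11aLowerHalf` at the twin). Real proof. -/
theorem twinPairUpper_of_upperNonSurjFive (h : PrintX11a.UpperNonSurjFive) : TwinPairUpper := by
  intro W _ _ p _ hX hns hp W' _ _ d _ _ hX' hns'
  exact pairUpperAt_of_upper_of_upper (h W p hX hns hp) (h W' p hX' hns' hp)

/-! ## Composition: the stubs conclude the crux BY NAME -/

/-- `UpperNonSurjFive` from TF1 (joint upper bound at admissible twins), TF2 (an admissible Class-X11a twin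
exists) and the route's lower-half crux `X11aLowerHalf` (item 19064). Real proof. -/
theorem UpperNonSurjFive_of_twinflip (h₁ : TwinPairUpper) (h₂ : TwinExists)
    (h₃ : PrintX11a.X11aLowerHalf) : PrintX11a.UpperNonSurjFive := by
  intro W _ _ p _ hX hns hp
  obtain ⟨d, W', hE', hM', hadm, htw, hX', hns'⟩ := h₂ W p hX hns hp
  have hpair : PairUpperAt W W' p := h₁ W p hX hns hp W' d hadm htw hX' hns'
  exact missingUpperBoundAt_of_pairUpperAt_of_lower hpair (h₃ W' p hX')

/-- The same, fed by the sorried stubs of this file (shape check only). -/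
theorem UpperNonSurjFive_of_stubs : PrintX11a.UpperNonSurjFive :=
  UpperNonSurjFive_of_twinflip stub_twinPairUpper stub_twinExists stub_lowerHalf

end Summit.BirchSwinnertonDyer.BirchSwinnertonDyer.Cruxes.UpperNonSurjFive.TwinFlip
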